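import Literature.AlgebraicGeometry.ModuliOfAbelianVarieties.SiegelAdelicCongrTransport
import Literature.AlgebraicGeometry.Motives.AbelianVarietyConjugate
import Literature.AlgebraicGeometry.Motives.AbelianVarietyHomTorsionDetermined
import HarnessLib

/-!
# The CM conjugation homomorphism `σA → A′` of the moduli interpretation INTERTWINES every pair of endomorphisms with one rational
# representation through the markings ([Milne 2005] §14 p. 125, Thm. 11.2; [Shimura 1998] §21.4; [Deligne 1971] 4.19)

Topic `AlgebraicGeometry/ModuliOfAbelianVarieties`; namespace `Literature.AlgebraicGeometry.ModuliOfAbelianVarieties.SiegelAdelicMarking`.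
THEOREMS ONLY (no definition, no named fact, no instance, no `sorry`; net Literature debt 0).  Cell `hodgecm-mathlib` (D-0151), FLOOR 0, P6
door (E) of `stub_RGD`, E6 step 8 (descent `ℂ → Fᵢ` of the `𝒪_F`-action via ★ B-γ `existsUnique_hom_pullback_map_eq_of_forall_exists_fieldPoint`:
Galois conjugates of the endomorphism must agree on one fibre per connected component) — **E6-γ core**: at a special point the witness is the
CM conjugation hom `f : σA → A′` of ★ `MumfordModuli.CMConjugationIsogenyAll` (★ `MumfordRouteXi.cmConjugationIsogenyAll_holds`, exposed by ★
`F0P6aSiegelCarrierReciprocity.smul_q_mk_eq_of_conjHom`), and THIS file shows it intertwines `y_b^σ` with `y′_b`.  `--supports stmt-HodgeConjecture-24832`,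
count-neutral; HC_CM is proved only modulo the printed citations until rung 0 closes.

THE STATEMENT.  Markings `m` of `A` by `[J, a]` and `m′` of `A′` by `[J′, a′]` (★ `SiegelAdelicMarking`), adelic matrices `B, B′` and a homomorphism
`f : σA → A′` with `f((m.r v)^σ) = m′.r w` whenever `B·v ≡ B′·w (mod ẑ^{2g})` (★ `AdelicCongr`; the conclusion shape of `CMConjugationIsogenyAll` with
`B = a⁻¹`, `B′ = (r·a)⁻¹`); a rational matrix `ℓ` PRESERVING the congruence (`AdelicCongr B B′ v w → AdelicCongr B B′ (ℓv) (ℓw)` — e.g. `ℓ` integral on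
`ẑ^{2g}` and commuting with `B, B′`: the CM action `act(b, b)` commutes with the `F ⊗ 𝔸_f`-linear `ũ_V(a,1)` and with the reciprocity element
`r ∈ act(F ⊗ 𝔸_f)`); endomorphisms `y` of `A` and `y′` of `A′` acting on the rational torsion through the markings by `ℓ` (`y(m.r v) = m.r(ℓv)`,
`y′(m′.r w) = m′.r(ℓw)`).  THEN `f ∘ y^σ = y′ ∘ f` (`conjugate_comp_eq_comp_of_adelicCongr`; ED. 2 adds the two-representation form
`conjugate_comp_eq_comp_of_adelicCongr₂`, `y` reading `ℓ` and `y′` reading `ℓ′` with `(ℓ, ℓ′)` congruence-preserving): both sides agree on the conjugates of the rational torsion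
points `(m.r v)^σ`, which exhaust the torsion of `σA` (★ `exists_r_eq_of_mem_torsionPoints`, ★ `conjPoints`), and a homomorphism of complex abelian
varieties is determined by its values on torsion points (★ `hom_eq_of_forall_torsionPoints_map`, [MumfordAV1970] §19 Thm. 3).
[Milne2005ShimuraVarieties] §14 p. 125 («`σ(A, i, …) ≅ (A′, i′, …)` … commuting with the action of `Aut(ℂ)`»); [Shimura1998] §21.4 (`λ ∘ ι(a)^σ = ι′(a) ∘ λ`).

## References
* [Milne2005ShimuraVarieties] J. S. Milne, *Introduction to Shimura varieties* (2005), §11 Thm. 11.2 p. 108, §14 Prop. 14.12 p. 125, §6 Thm. 6.11 p. 74.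
* [Shimura1998] G. Shimura, *Abelian Varieties with Complex Multiplication and Modular Functions* (1998), §18.6 Thm. 18.6, §21.4 p. 192.
* [Deligne1971TravauxShimura] P. Deligne, *Travaux de Shimura* (1971), 4.19 p. 151.
* [MumfordAV1970] D. Mumford, *Abelian Varieties* (1970), §19 Thm. 3 and Cor. 1.
-/

set_option autoImplicit false

noncomputable section

open Matrix NumberField IsDedekindDomain CategoryTheory

namespace Literature.AlgebraicGeometry.ModuliOfAbelianVarieties

namespace SiegelAdelicMarking

open Literature.AlgebraicGeometry.Motives (AbelianVariety AlgPoints ComplexPoints)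

variable {g : ℕ} {δ : Fin g → ℕ}

/-- **E6-γ CORE — THE CM CONJUGATION HOMOMORPHISM INTERTWINES ENDOMORPHISMS WITH THE SAME RATIONAL REPRESENTATION** ([Milne2005ShimuraVarieties] §14
p. 125 with Thm. 11.2; [Shimura1998] §21.4 «`λ(ι(a)^σ x) = ι′(a) λ(x)`»).  Let `m`, `m′` mark `A`, `A′` by `[J, a]`, `[J′, a′]`; let `f : σA → A′` satisfy
`f((m.r v)^σ) = m′.r w` whenever `B·v ≡ B′·w (mod ẑ^{2g})`; let the rational matrix `ℓ` preserve this congruence; and let `y ∈ End A`, `y′ ∈ End A′` act on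
the rational torsion through the markings by `ℓ`.  Then `y^σ ≫ f = f ≫ y′` (diagrammatic; `f ∘ y^σ = y′ ∘ f`).  The B-γ descent hypothesis of the E6 closer at
a special point, with `f` = the CM conjugation isogeny of ★ `cmConjugationIsogenyAll_holds` and `ℓ = act(b, b)` the CM multiplication.
[cite: Milne2005ShimuraVarieties, §14 Prop. 14.12 p. 125 and §11 Thm. 11.2 p. 108] [cite: Shimura1998, §21.4 p. 192] [cite: MumfordAV1970, §19 Thm. 3 and Cor. 1] -/
theorem conjugate_comp_eq_comp_of_adelicCongr (τ : ℂ ≃+* ℂ) {J J' : C0pm δ} {a a' : gspFinAdelic δ} {A A' : AbelianVariety ℂ}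
    (m : SiegelAdelicMarking J a A) (m' : SiegelAdelicMarking J' a' A') (B B' : GL (Fin g ⊕ Fin g) finAdeleQ)
    (f : A.conjugate τ ⟶ A')
    (hf : ∀ v w : Fin g ⊕ Fin g → ℚ, AdelicCongr B B' v w → AlgPoints.map f.hom.hom.hom (A.conjPoints τ (m.r v)) = m'.r w)
    (ℓ : Matrix (Fin g ⊕ Fin g) (Fin g ⊕ Fin g) ℚ)
    (hℓ : ∀ v w : Fin g ⊕ Fin g → ℚ, AdelicCongr B B' v w → AdelicCongr B B' (ℓ *ᵥ v) (ℓ *ᵥ w))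
    (y : A ⟶ A) (hy : ∀ v : Fin g ⊕ Fin g → ℚ, AlgPoints.map y.hom.hom.hom (m.r v) = m.r (ℓ *ᵥ v))
    (y' : A' ⟶ A') (hy' : ∀ w : Fin g ⊕ Fin g → ℚ, AlgPoints.map y'.hom.hom.hom (m'.r w) = m'.r (ℓ *ᵥ w)) :
    AbelianVariety.Hom.conjugate τ y ≫ f = f ≫ y' := by
  refine AbelianVariety.hom_eq_of_forall_torsionPoints _ _ fun n hn Q hQ => ?_
  -- `Q = (m.r v)^τ` for a rational vector `v`
  obtain ⟨P, rfl⟩ := (A.conjPoints τ).surjective Q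
  have hP : P ∈ A.torsionPoints ℂ (n : ℤ) := (A.conjPoints_mem_torsionPoints_iff τ (n : ℤ) P).1 hQ
  obtain ⟨v, rfl⟩ := m.exists_r_eq_of_mem_torsionPoints (Nat.pos_iff_ne_zero.1 hn) hP
  obtain ⟨w, hw⟩ := exists_adelicCongr_right B B' v
  -- evaluate both composites on `(m.r v)^τ`
  change AlgPoints.map ((AbelianVariety.Hom.conjugate τ y ≫ f).hom.hom.hom) (A.conjPoints τ (m.r v)) =
    AlgPoints.map ((f ≫ y').hom.hom.hom) (A.conjPoints τ (m.r v))
  have h1 : AlgPoints.map ((AbelianVariety.Hom.conjugate τ y ≫ f).hom.hom.hom) (A.conjPoints τ (m.r v)) =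
      AlgPoints.map f.hom.hom.hom (AlgPoints.map (AbelianVariety.Hom.conjugate τ y).hom.hom.hom (A.conjPoints τ (m.r v))) := by
    simp only [AlgPoints.map_apply]
    exact (Category.assoc _ _ _).symm
  have h2 : AlgPoints.map ((f ≫ y').hom.hom.hom) (A.conjPoints τ (m.r v)) =
      AlgPoints.map y'.hom.hom.hom (AlgPoints.map f.hom.hom.hom (A.conjPoints τ (m.r v))) := by
    simp only [AlgPoints.map_apply]
    exact (Category.assoc _ _ _).symm
  rw [h1, h2, ← AbelianVariety.conjPoints_map, hy v, hf _ _ (hℓ v w hw), hf v w hw, hy' w]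

/-- **E6-γ CORE, TWO RATIONAL REPRESENTATIONS** (the form met when the two markings sit at DIFFERENT period points, so that the same
endomorphism letter reads `ℓ` through `m` and `ℓ′` through `m′` — e.g. `ℓ = q_a⁻¹·act(b)·q_a`, `ℓ′ = q_{a′}⁻¹·act(b)·q_{a′}` for the movers of two
representatives): if `f((m.r v)^τ) = m′.r w` whenever `B·v ≡ B′·w`, the pair `(ℓ, ℓ′)` preserves the congruence (`B·v ≡ B′·w ⇒ B·ℓv ≡ B′·ℓ′w`),
`y` reads `ℓ` through `m` and `y′` reads `ℓ′` through `m′`, then `y^τ ≫ f = f ≫ y′`.  Same proof as `conjugate_comp_eq_comp_of_adelicCongr`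
(which is the case `ℓ′ = ℓ`). [cite: Milne2005ShimuraVarieties, §14 Prop. 14.12 p. 125 and §11 Thm. 11.2 p. 108] [cite: Shimura1998, §21.4 p. 192]
[cite: MumfordAV1970, §19 Thm. 3 and Cor. 1] -/
theorem conjugate_comp_eq_comp_of_adelicCongr₂ (τ : ℂ ≃+* ℂ) {J J' : C0pm δ} {a a' : gspFinAdelic δ} {A A' : AbelianVariety ℂ}
    (m : SiegelAdelicMarking J a A) (m' : SiegelAdelicMarking J' a' A') (B B' : GL (Fin g ⊕ Fin g) finAdeleQ)
    (f : A.conjugate τ ⟶ A')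
    (hf : ∀ v w : Fin g ⊕ Fin g → ℚ, AdelicCongr B B' v w → AlgPoints.map f.hom.hom.hom (A.conjPoints τ (m.r v)) = m'.r w)
    (ℓ ℓ' : Matrix (Fin g ⊕ Fin g) (Fin g ⊕ Fin g) ℚ)
    (hℓ : ∀ v w : Fin g ⊕ Fin g → ℚ, AdelicCongr B B' v w → AdelicCongr B B' (ℓ *ᵥ v) (ℓ' *ᵥ w))
    (y : A ⟶ A) (hy : ∀ v : Fin g ⊕ Fin g → ℚ, AlgPoints.map y.hom.hom.hom (m.r v) = m.r (ℓ *ᵥ v))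
    (y' : A' ⟶ A') (hy' : ∀ w : Fin g ⊕ Fin g → ℚ, AlgPoints.map y'.hom.hom.hom (m'.r w) = m'.r (ℓ' *ᵥ w)) :
    AbelianVariety.Hom.conjugate τ y ≫ f = f ≫ y' := by
  refine AbelianVariety.hom_eq_of_forall_torsionPoints _ _ fun n hn Q hQ => ?_
  obtain ⟨P, rfl⟩ := (A.conjPoints τ).surjective Q
  have hP : P ∈ A.torsionPoints ℂ (n : ℤ) := (A.conjPoints_mem_torsionPoints_iff τ (n : ℤ) P).1 hQ
  obtain ⟨v, rfl⟩ := m.exists_r_eq_of_mem_torsionPoints (Nat.pos_iff_ne_zero.1 hn) hP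
  obtain ⟨w, hw⟩ := exists_adelicCongr_right B B' v
  change AlgPoints.map ((AbelianVariety.Hom.conjugate τ y ≫ f).hom.hom.hom) (A.conjPoints τ (m.r v)) =
    AlgPoints.map ((f ≫ y').hom.hom.hom) (A.conjPoints τ (m.r v))
  have h1 : AlgPoints.map ((AbelianVariety.Hom.conjugate τ y ≫ f).hom.hom.hom) (A.conjPoints τ (m.r v)) =
      AlgPoints.map f.hom.hom.hom (AlgPoints.map (AbelianVariety.Hom.conjugate τ y).hom.hom.hom (A.conjPoints τ (m.r v))) := by
    simp only [AlgPoints.map_apply]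
    exact (Category.assoc _ _ _).symm
  have h2 : AlgPoints.map ((f ≫ y').hom.hom.hom) (A.conjPoints τ (m.r v)) =
      AlgPoints.map y'.hom.hom.hom (AlgPoints.map f.hom.hom.hom (A.conjPoints τ (m.r v))) := by
    simp only [AlgPoints.map_apply]
    exact (Category.assoc _ _ _).symm
  rw [h1, h2, ← AbelianVariety.conjPoints_map, hy v, hf _ _ (hℓ v w hw), hf v w hw, hy' w]

end SiegelAdelicMarking

end Literature.AlgebraicGeometry.ModuliOfAbelianVarieties

end
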